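/-
Copyright (c) 2026. Released under the Apache 2.0 license.
-/
import Literature.NumberTheory.EllipticCurves.IsogenyNeronScalingMinimalDiscriminantDirectionProofs
import Literature.NumberTheory.EllipticCurves.SemistabilityDefectIsogenyProofs
import Literature.NumberTheory.EllipticCurves.IsogenyOddKernelFourthPowerProofs
import Literature.NumberTheory.EllipticCurves.SemistabilityDefectAtThreeTameWitnessProofs
import Literature.NumberTheory.DiophantineGeometry.TameAdditiveTypesAtTwoProofs
import HarnessLib

/-!
# A `3`-isogeny out of a Kodaira-III curve at `3` (tame quartic row, `ord_3 Δ_min = 3`) is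
# étale on Néron differentials: `3 ∤ α` — PROOFS
# (Dokchitser–Dokchitser 2015, Table 1 / Cor. 8 at `l = p = 3`, row "pot. supersingular tame")

`Proofs` file (theorems only: no definition, no named fact, no instance), topic
`NumberTheory/EllipticCurves`. Dokchitser–Dokchitser, *Local invariants of isogenous elliptic
curves*, Trans. AMS 367 (2015) = arXiv:1208.5519, Table 1 (p. 3), row `l = p`, "pot.
supersingular tame: `δ' = 12 − δ`, Kodaira: opposite", with Cor. 8 (p. 6): for a `p`-isogeny at a
prime of additive tame potentially good reduction, "if the reduction is potentially supersingular
then `δ = 12 − δ'` and `E, E'` have opposite Kodaira types (`III ↔ III*`, …)"; the possibility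
`δ = 3, δ' = 9, p ≡ 3 mod 4` of its proof is the case `p = 3`, type III. In the differential
column the paper prints "?" for this row; Gealy–Klagsbrun 2017 Thm. 1 fills it at `K = ℚ_p`:
`α_φ = 1` if `v_min(E) < v_min(E')`. This file proves, with no named fact, the statement the
route `TameQuarticManinParity` types as F19♭ (`TprimeRedKodairaThreeForcesNeronUnit`, item
stmt-BirchSwinnertonDyer-27922), in Literature vocabulary (Kodaira symbol instead of the route's
`SubTprime`):

* `not_three_dvd_neronScaling_of_kodairaSymbolAt_three_eq_III` — `W/ℚ` globally minimal with
  Kodaira symbol III or III* at `3` and `ord_3 Δ_min(W) = 3` (i.e. type III); `W₂/ℚ` globally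
  minimal; Néron period pairs `L, L₂`; `α ∈ ℤ` with `αΛ_W ⊆ Λ_{W₂}` of index `3`. Then `3 ∤ α`
  (`α_φ = 1`: the `3`-isogeny `z ↦ αz` pulls the Néron differential of `W₂` back to a `3`-adic UNIT
  multiple of that of `W`), and `9 ≤ ord_3 Δ_min(W₂)`.

## Proof (all steps are tree theorems; this file only assembles them)

1. `φ : W → W₂`, the `ℚ`-isogeny `z ↦ αz`, has degree `[Λ_{W₂} : αΛ_W] = 3`
   (`exists_isogeny_baseChange_apply_eq_of_forall_mul_mem_lattice`).
2. `3·ord_3 Δ_min(W) ≡ ord_3 Δ_min(W₂) (mod 4)` (Dokchitser–Dokchitser Thm. 5/6: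
   `Isogeny.padicValInt_minimalDiscriminantInt_modEq_four_of_degree_eq_three`), so
   `ord_3 Δ_min(W₂) ≡ 9 ≡ 1 (mod 4)`.
3. `W₂` is potentially good at `3` (`padicValRat_j_nonneg_of_isogeny`) with the same semistability
   defect `4` as `W` (`Isogeny.semistabilityDefectAt_eq`,
   `semistabilityDefectAt_eq_four_of_kodairaSymbolAt_eq_III_or_IIIstar`), hence
   `12/gcd(12, ord_3 Δ_min(W₂)) ∣ 4` (`twelve_div_gcd_ordMinimalDiscriminant_dvd_semistabilityDefectAt`)
   and `3 ∣ ord_3 Δ_min(W₂)`; with step 2, `ord_3 Δ_min(W₂) ≥ 9 > 3 = ord_3 Δ_min(W)`: a RISE.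
4. Along a rise of `ord_p Δ_min` a `p`-isogeny has `p ∤ α` (Gealy–Klagsbrun Prop. 2.1 + Cor. 3.2:
   `dvd_and_not_dvd_neronScaling_of_padicValInt_minimalDiscriminantInt_lt_of_relIndex_eq`).

No inseparability / supersingularity argument and no hypothesis on `W₂` beyond global minimality
are used; in particular the named fact `gealyKlagsbrun2017_neronScalar_of_additive_potSupersingular`
is NOT invoked. Cell context: with the Summits-side dictionary
`subTprime_three_iff_kodairaSymbolAt_III_or_IIIstar` this is item 27922 of route
`TameQuarticManinParity` (LINE 20, critic V103 price 2/3 "landable now"); nothing else of that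
route, and no leaf, rung, crux or summit, is proved here. BSD is not proved.

## References
* [DokchitserDokchitser2015LocalInvariants] Table 1 (arXiv:1208.5519 p. 3), §2 Thm. 5, §3 Thm. 6
  and Cor. 8 (pp. 5–6).
* [GealyKlagsbrun2017] Thm. 1, Prop. 2.1, Cor. 3.2 (arXiv:1703.02148 pp. 3, 5, 6).
* [Kraus1990] / [Coppola2020] §2 (semistability defect).
* [SilvermanAEC2009] VII.5.5, VII.7.2; [SilvermanATAEC1994] IV.9 Table 4.1 (types III, III*).
-/

noncomputable section

open scoped Classical

namespace Literature.NumberTheory.EllipticCurves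

open _root_.WeierstrassCurve _root_.IsDedekindDomain _root_.NumberField _root_.PeriodPair
  ModularForms Rat.HeightOneSpectrum

/-- Arithmetic of step 3: `12/gcd(12, n) ∣ 4` forces `3 ∣ n`, and with `n ≡ 9 (mod 4)` then
`9 ≤ n`. [folklore] -/
private theorem nine_le_of_twelve_div_gcd_dvd_four_of_modEq {n : ℕ} (h4 : 12 / Nat.gcd 12 n ∣ 4)
    (hmod : (9 : ℤ) ≡ (n : ℤ) [ZMOD 4]) : 9 ≤ n := by
  have key : ∀ r < 12, 12 / Nat.gcd r 12 ∣ 4 → 3 ∣ r := by decide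
  rw [Nat.gcd_rec] at h4
  have h3 : 3 ∣ n % 12 := key (n % 12) (Nat.mod_lt _ (by norm_num)) h4
  obtain ⟨c, hc⟩ := Int.modEq_iff_dvd.mp hmod
  omega

/-- **A `3`-isogeny out of a type-III curve at `3` is étale on Néron differentials**
(Dokchitser–Dokchitser 2015, Table 1 row "`l = p`, pot. supersingular tame" with Cor. 8
(`III ↔ III*`, `δ' = 12 − δ`) at `p = 3`; differential column by Gealy–Klagsbrun 2017 Thm. 1:
`α_φ = 1` along a rise of `v_min`). Let `W/ℚ` be globally minimal with Kodaira symbol III or III*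
at the place `v` of `3` and `ord_3 Δ_min(W) = 3`, `W₂/ℚ` globally minimal, `L, L₂` Néron period
pairs, `α ∈ ℤ` with `αΛ_W ⊆ Λ_{W₂}` of index `3`. Then `3 ∤ α`, and `9 ≤ ord_3 Δ_min(W₂)`.
Assembled from: the isogeny `z ↦ αz` of degree `3`
(`exists_isogeny_baseChange_apply_eq_of_forall_mul_mem_lattice`); `3δ ≡ δ₂ (mod 4)`
(`Isogeny.padicValInt_minimalDiscriminantInt_modEq_four_of_degree_eq_three`); isogeny invariance
of the defect (`Isogeny.semistabilityDefectAt_eq`) with `defect = 4` for III/III*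
(`semistabilityDefectAt_eq_four_of_kodairaSymbolAt_eq_III_or_IIIstar`) and
`12/gcd(12, δ₂) ∣ defect` (`twelve_div_gcd_ordMinimalDiscriminant_dvd_semistabilityDefectAt`);
and the rise clause of `dvd_and_not_dvd_neronScaling_of_padicValInt_minimalDiscriminantInt_lt_of_relIndex_eq`.
[cite: DokchitserDokchitser2015LocalInvariants, Table 1 (arXiv:1208.5519 p. 3) with §3 Cor. 8 and Thm. 6 (p. 6), §2 Thm. 5 (p. 5)]
[cite: GealyKlagsbrun2017, Thm. 1 clause "α = 1 if v_min(E/K) < v_min(E′/K)" via Prop. 2.1 and Cor. 3.2 (arXiv:1703.02148 pp. 3, 5–6)] -/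
theorem not_three_dvd_neronScaling_of_kodairaSymbolAt_three_eq_III
    (W W₂ : WeierstrassCurve ℚ) [W.IsElliptic] [W₂.IsElliptic] [W.IsGloballyMinimal]
    [W₂.IsGloballyMinimal] (v : HeightOneSpectrum ℤ)
    (hv : ((primesEquiv (R := ℤ) v : Nat.Primes) : ℕ) = 3)
    (hK : W.kodairaSymbolAt v = .III ∨ W.kodairaSymbolAt v = .IIIstar)
    (hδ : padicValInt 3 W.minimalDiscriminantInt = 3) (L L₂ : PeriodPair) (α : ℤ)
    (hL : IsNeronLatticeOf (W.baseChange ℂ) L) (hL₂ : IsNeronLatticeOf (W₂.baseChange ℂ) L₂)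
    (hα : ∀ z ∈ L.lattice, (α : ℂ) * z ∈ L₂.lattice)
    (hidx : (L.lattice.toAddSubgroup.map (AddMonoidHom.mulLeft (α : ℂ))).relIndex
      L₂.lattice.toAddSubgroup = 3) :
    ¬ (3 : ℤ) ∣ α ∧ 9 ≤ padicValInt 3 W₂.minimalDiscriminantInt := by
  classical
  haveI h3 : Fact (Nat.Prime 3) := ⟨Nat.prime_three⟩
  have hp2 : (3 : ℕ) ≠ 2 := by decide
  -- `W`: potentially good at `3`, semistability defect `4`
  have hj : 0 ≤ padicValRat 3 W.j :=
    W.padicValRat_j_nonneg_of_kodairaSymbolAt_eq_III_or_IIIstar v hv hp2 hK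
  have hdefW : W.semistabilityDefectAt 3 = 4 :=
    W.semistabilityDefectAt_eq_four_of_kodairaSymbolAt_eq_III_or_IIIstar v hv hp2 hK
  -- the rise clause of the direction theorem
  obtain ⟨-, hrise⟩ :=
    dvd_and_not_dvd_neronScaling_of_padicValInt_minimalDiscriminantInt_lt_of_relIndex_eq W W₂ 3 L
      L₂ α hL hL₂ hα hidx hj
  -- `3Λ₂ ⊆ αΛ`, hence `α ∣ 3` and `α ≠ 0`
  have hpα : ∀ z ∈ L₂.lattice, ∃ y ∈ L.lattice, ((3 : ℕ) : ℂ) * z = (α : ℂ) * y := by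
    intro z hz
    have h := AddSubgroup.nsmul_relIndex_mem
      (L.lattice.toAddSubgroup.map (AddMonoidHom.mulLeft (α : ℂ))) (K := L₂.lattice.toAddSubgroup)
      (show z ∈ L₂.lattice.toAddSubgroup from hz)
    rw [hidx, AddSubgroup.mem_map] at h
    obtain ⟨y, hy, hyz⟩ := h
    have hyz' : (α : ℂ) * y = (3 : ℕ) • z := hyz
    refine ⟨y, hy, ?_⟩
    rw [hyz', nsmul_eq_mul]
  have hp0 : ((3 : ℕ) : ℤ) ≠ 0 := by decide
  obtain ⟨k, hk, hk3⟩ := exists_int_eq_and_dvd_of_neronScaling W W₂ L L₂ hL hL₂ (α : ℚ) hp0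
    (by simpa using hα) (by simpa using hpα)
  have hkα : k = α := by exact_mod_cast hk
  rw [hkα] at hk3
  have hα0 : α ≠ 0 := by
    rintro rfl
    exact absurd (zero_dvd_iff.mp hk3) (by decide)
  -- the `ℚ`-isogeny `z ↦ αz`, of degree `3`
  haveI hQbar : Algebra.IsAlgebraic ℚ (AlgebraicClosure ℚ) := AlgebraicClosure.isAlgebraic ℚ
  letI : Algebra (AlgebraicClosure ℚ) ℂ :=
    (IsAlgClosed.lift : AlgebraicClosure ℚ →ₐ[ℚ] ℂ).toRingHom.toAlgebra
  haveI : IsScalarTower ℚ (AlgebraicClosure ℚ) ℂ :=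
    IsScalarTower.of_algebraMap_eq' (Subsingleton.elim _ _)
  haveI hWC : (W.baseChange ℂ).IsElliptic := by
    rw [WeierstrassCurve.baseChange]; infer_instance
  haveI hWC₂ : (W₂.baseChange ℂ).IsElliptic := by
    rw [WeierstrassCurve.baseChange]; infer_instance
  obtain ⟨h₂, h₃⟩ := hL
  obtain ⟨h₂', h₃'⟩ := hL₂
  obtain ⟨u, hkeru, hsurj, hu⟩ := L.exists_addMonoidHom_of_g₂_g₃' h₂ h₃
  obtain ⟨u', hkeru', -, hu'⟩ := L₂.exists_addMonoidHom_of_g₂_g₃' h₂' h₃'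
  have hαQ0 : (α : ℚ) ≠ 0 := by exact_mod_cast hα0
  have hαC : (α : ℂ) ≠ 0 := by exact_mod_cast hα0
  have hle : ∀ z ∈ L.lattice, ((α : ℚ) : ℂ) * z ∈ L₂.lattice := fun z hz ↦ by
    rw [Rat.cast_intCast]; exact hα z hz
  obtain ⟨φ, -, -, hdegφ⟩ := exists_isogeny_baseChange_apply_eq_of_forall_mul_mem_lattice
    h₂ h₃ h₂' h₃' hkeru hsurj hu hkeru' hu' hαQ0 hle
  have hdeg3 : φ.degree = 3 := by
    rw [hdegφ, ← hidx, map_mulLeft_lattice_toAddSubgroup hαC]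
    simp only [Rat.cast_intCast]
  -- `3·δ ≡ δ₂ (mod 4)`, i.e. `δ₂ ≡ 9 (mod 4)`
  have hmod := φ.padicValInt_minimalDiscriminantInt_modEq_four_of_degree_eq_three hdeg3 3
  rw [hδ] at hmod
  norm_num at hmod
  -- `W₂`: potentially good, defect `4`, so `3 ∣ δ₂`
  have hj₂ : 0 ≤ padicValRat 3 W₂.j := padicValRat_j_nonneg_of_isogeny φ Nat.prime_three hj
  have hdef₂ : W₂.semistabilityDefectAt 3 = 4 := by rw [← φ.semistabilityDefectAt_eq 3, hdefW]
  have hdvd := W₂.twelve_div_gcd_ordMinimalDiscriminant_dvd_semistabilityDefectAt v hv hj₂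
  have hgen : natGenerator v = 3 := hv
  rw [hdef₂, W₂.ordMinimalDiscriminant_eq_padicValInt_natGenerator' v, hgen] at hdvd
  have h9 : 9 ≤ padicValInt 3 W₂.minimalDiscriminantInt :=
    nine_le_of_twelve_div_gcd_dvd_four_of_modEq hdvd hmod
  refine ⟨hrise ?_, h9⟩
  rw [hδ]
  omega

end Literature.NumberTheory.EllipticCurves

end
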